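import Summits.AtomisticToContinuum.BoseEinsteinCondensation.Theorems.BoxCountShadow
import HarnessLib

/-!
# BoxCountShadow — PART B (§3) of lens-6 g35 `BoxCountShadow.lean` (sha256 11126a30378dce1a), split at section boundaries for the
# 400-line rule by hand-2 g11 at landing; declaration bodies byte-identical, same namespace `…Theorems.BoxCountShadow`.
-/


open MeasureTheory Filter Set
open scoped ENNReal NNReal BigOperators

namespace Summit.AtomisticToContinuum.BoseEinsteinCondensation.Theorems.BoxCountShadow

open Literature.MathematicalPhysics.QuantumManyBody.BoseGas
open Summit.AtomisticToContinuum.BoseEinsteinCondensation.Theorems.BoxLatticeFSum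
open Summit.AtomisticToContinuum.BoseEinsteinCondensation.Theorems.BoxLabelAffinity
open Summit.AtomisticToContinuum.BoseEinsteinCondensation.Theorems.BoxHorizonAffinity

variable {n : ℕ}

/-! ### §3  The inequalities between the physical objects -/

/-- **LAB ≤ NUM functional**: `labelAffinity L K Φ ≤ countAffinity L K Φ` for every measurable `Φ` — the
label affinity given the whole environment is at most the label affinity given only its count field
(data processing). [folklore] -/
theorem labelAffinity_le_countAffinity (L : ℝ) (K : ℕ) {Φ : Config (n + 1) → ℝ} (hΦm : Measurable Φ) :
    labelAffinity L K Φ ≤ countAffinity L K Φ :=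
  label_le_count_core (Finset.univ : Finset (SubIdx K)) volume (fun _ => blockWeight K)
    (measurable_countVec (L / (K : ℝ)) K) (measurable_sliceSq hΦm) (measurable_blockMass L K hΦm)

/-- The blocks tile the cell: `Σ_B q_B(Y) ≤ P̂(Y)`. [folklore] -/
theorem sum_blockMass_le_sliceSq {L : ℝ} {K : ℕ} (hL : 0 < L) (hK : 0 < K) {Φ : Config (n + 1) → ℝ}
    (hΦm : Measurable Φ) (Y : Config n) : ∑ B : SubIdx K, blockMass L K Φ B Y ≤ sliceSq Φ Y := by
  have hKr : (0 : ℝ) < K := by exact_mod_cast hK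
  have hℓ : 0 < L / (K : ℝ) := div_pos hL hKr
  have hF : Measurable fun x => ENNReal.ofReal (Φ (Matrix.vecCons x Y)) ^ 2 :=
    ((measurable_uncurry_slice hΦm).pow_const 2).comp (measurable_id.prodMk measurable_const)
  unfold blockMass sliceSq
  calc ∑ B : SubIdx K, ∫⁻ x in subCell (L / (K : ℝ)) B, ENNReal.ofReal (Φ (Matrix.vecCons x Y)) ^ 2
      = ∑ B : SubIdx K, ∫⁻ x, (subCell (L / (K : ℝ)) B).indicator
          (fun x => ENNReal.ofReal (Φ (Matrix.vecCons x Y)) ^ 2) x :=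
        Finset.sum_congr rfl fun B _ => (lintegral_indicator (measurableSet_subCell _ B) _).symm
    _ = ∫⁻ x, ∑ B : SubIdx K, (subCell (L / (K : ℝ)) B).indicator
          (fun x => ENNReal.ofReal (Φ (Matrix.vecCons x Y)) ^ 2) x :=
        (lintegral_finsetSum _ fun B _ => hF.indicator (measurableSet_subCell _ B)).symm
    _ = ∫⁻ x, (cell ((K : ℝ) * (L / (K : ℝ)))).indicator
          (fun x => ENNReal.ofReal (Φ (Matrix.vecCons x Y)) ^ 2) x :=
        lintegral_congr fun x => sum_indicator_subCell hℓ _ x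
    _ ≤ ∫⁻ x, ENNReal.ofReal (Φ (Matrix.vecCons x Y)) ^ 2 := by
        refine lintegral_mono fun x => ?_
        by_cases hx : x ∈ cell ((K : ℝ) * (L / (K : ℝ)))
        · rw [Set.indicator_of_mem hx]
        · rw [Set.indicator_of_notMem hx]; simp only [zero_le]

/-- `Q̄(m) = Σ_B Q(B,m) ≤ P̄(m)` (equality for `Φ` supported in the box). [folklore] -/
theorem sum_fibreMass_le_fibreSlice {L : ℝ} {K : ℕ} (hL : 0 < L) (hK : 0 < K) {Φ : Config (n + 1) → ℝ}
    (hΦm : Measurable Φ) (m : SubIdx K → ℕ) :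
    ∑ B : SubIdx K, fibreMass L K Φ B m ≤ fibreSlice L K Φ m := by
  unfold fibreMass fibreSlice
  rw [← lintegral_finsetSum _ fun B _ => measurable_blockMass L K hΦm B]
  exact lintegral_mono fun Y => sum_blockMass_le_sliceSq hL hK hΦm Y

/-- `Σ'_m P̄(m) = ∫ P̂`. [folklore] -/
theorem tsum_fibreSlice (L : ℝ) (K : ℕ) (Φ : Config (n + 1) → ℝ) :
    ∑' m, fibreSlice L K Φ m = ∫⁻ Y : Config n, sliceSq Φ Y :=
  (lintegral_eq_tsum_fibre volume (measurable_countVec (L / (K : ℝ)) K) (sliceSq Φ)).symm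

/-- **The count affinity is an affinity**: `countAffinity ≤ 1` for a normalised amplitude. [folklore] -/
theorem countAffinity_le_one {L : ℝ} {K : ℕ} (hL : 0 < L) (hK : 0 < K) {Φ : Config (n + 1) → ℝ}
    (hΦm : Measurable Φ) (hΦ1 : ∫⁻ Y : Config n, ∫⁻ x, ENNReal.ofReal (Φ (Matrix.vecCons x Y)) ^ 2 = 1) :
    countAffinity L K Φ ≤ 1 := by
  have sq_rpow_half : ∀ m : ℝ≥0∞, (m ^ (1 / 2 : ℝ)) ^ 2 = m := fun m => by
    rw [← ENNReal.rpow_two, ← ENNReal.rpow_mul]; norm_num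
  have hP : ∑' m, fibreSlice L K Φ m = 1 := by rw [tsum_fibreSlice]; exact hΦ1
  unfold countAffinity
  calc ∑' m : SubIdx K → ℕ, fibreSlice L K Φ m ^ (1 / 2 : ℝ) *
        ∑ B : SubIdx K, blockWeight K * fibreMass L K Φ B m ^ (1 / 2 : ℝ)
      ≤ ∑' m : SubIdx K → ℕ, fibreSlice L K Φ m ^ (1 / 2 : ℝ) *
          ((∑ _B : SubIdx K, blockWeight K ^ 2) ^ (1 / 2 : ℝ) *
            (∑ B : SubIdx K, fibreMass L K Φ B m) ^ (1 / 2 : ℝ)) :=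
        ENNReal.tsum_le_tsum fun m => mul_le_mul' le_rfl (sum_mul_rpow_half_le _ _ _)
    _ ≤ ∑' m : SubIdx K → ℕ, fibreSlice L K Φ m ^ (1 / 2 : ℝ) * fibreSlice L K Φ m ^ (1 / 2 : ℝ) := by
        refine ENNReal.tsum_le_tsum fun m => mul_le_mul' le_rfl ?_
        rw [sum_blockWeight_sq hK, ENNReal.one_rpow, one_mul]
        exact ENNReal.rpow_le_rpow (sum_fibreMass_le_fibreSlice hL hK hΦm m) (by norm_num)
    _ = ∑' m : SubIdx K → ℕ, fibreSlice L K Φ m := by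
        refine tsum_congr fun m => ?_
        rw [← sq, sq_rpow_half]
    _ = 1 := hP

/-- `countTransfer ≤ countAffinity` (Cauchy–Schwarz in `B`: `K^{-3/2} Σ_B Q(B,m)^{1/2} ≤ Q̄(m)^{1/2} ≤
P̄(m)^{1/2}`). [folklore] -/
theorem countTransfer_le_countAffinity {L : ℝ} {K : ℕ} (hL : 0 < L) (hK : 0 < K)
    {Φ : Config (n + 1) → ℝ} (hΦm : Measurable Φ) : countTransfer L K Φ ≤ countAffinity L K Φ := by
  unfold countTransfer countAffinity
  refine ENNReal.tsum_le_tsum fun m => ?_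
  rw [sq]
  refine mul_le_mul' ?_ le_rfl
  calc ∑ B : SubIdx K, blockWeight K * fibreMass L K Φ B m ^ (1 / 2 : ℝ)
      ≤ (∑ _B : SubIdx K, blockWeight K ^ 2) ^ (1 / 2 : ℝ) *
          (∑ B : SubIdx K, fibreMass L K Φ B m) ^ (1 / 2 : ℝ) := sum_mul_rpow_half_le _ _ _
    _ ≤ fibreSlice L K Φ m ^ (1 / 2 : ℝ) := by
        rw [sum_blockWeight_sq hK, ENNReal.one_rpow, one_mul]
        exact ENNReal.rpow_le_rpow (sum_fibreMass_le_fibreSlice hL hK hΦm m) (by norm_num)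

/-- `countAffinity² ≤ countTransfer` for a normalised amplitude (Cauchy–Schwarz in `m`): together with
`countTransfer_le_countAffinity`, INSERTION tolerance and PAIR-AVERAGED TRANSFER tolerance of the count law are
equivalent currencies, `T ≤ A ≤ T^{1/2}`. [folklore] -/
theorem countAffinity_sq_le_countTransfer (L : ℝ) (K : ℕ) {Φ : Config (n + 1) → ℝ}
    (hΦ1 : ∫⁻ Y : Config n, ∫⁻ x, ENNReal.ofReal (Φ (Matrix.vecCons x Y)) ^ 2 = 1) :
    countAffinity L K Φ ^ 2 ≤ countTransfer L K Φ := by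
  have rpow_half_sq : ∀ m : ℝ≥0∞, (m ^ 2) ^ (1 / 2 : ℝ) = m := fun m => by
    rw [← ENNReal.rpow_two, ← ENNReal.rpow_mul]; norm_num
  have sq_rpow_half : ∀ m : ℝ≥0∞, (m ^ (1 / 2 : ℝ)) ^ 2 = m := fun m => by
    rw [← ENNReal.rpow_two, ← ENNReal.rpow_mul]; norm_num
  have hP : ∑' m, fibreSlice L K Φ m = 1 := by rw [tsum_fibreSlice]; exact hΦ1
  have h : countAffinity L K Φ ≤ countTransfer L K Φ ^ (1 / 2 : ℝ) := by
    unfold countAffinity countTransfer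
    calc ∑' m : SubIdx K → ℕ, fibreSlice L K Φ m ^ (1 / 2 : ℝ) *
          ∑ B : SubIdx K, blockWeight K * fibreMass L K Φ B m ^ (1 / 2 : ℝ)
        = ∑' m : SubIdx K → ℕ, fibreSlice L K Φ m ^ (1 / 2 : ℝ) *
            ((∑ B : SubIdx K, blockWeight K * fibreMass L K Φ B m ^ (1 / 2 : ℝ)) ^ 2) ^ (1 / 2 : ℝ) := by
          simp_rw [rpow_half_sq]
      _ ≤ (∑' m : SubIdx K → ℕ, fibreSlice L K Φ m) ^ (1 / 2 : ℝ) *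
            (∑' m : SubIdx K → ℕ,
              (∑ B : SubIdx K, blockWeight K * fibreMass L K Φ B m ^ (1 / 2 : ℝ)) ^ 2) ^ (1 / 2 : ℝ) :=
          tsum_rpow_half_mul_le _ _
      _ = (∑' m : SubIdx K → ℕ,
              (∑ B : SubIdx K, blockWeight K * fibreMass L K Φ B m ^ (1 / 2 : ℝ)) ^ 2) ^ (1 / 2 : ℝ) := by
          rw [hP, ENNReal.one_rpow, one_mul]
  calc countAffinity L K Φ ^ 2 ≤ (countTransfer L K Φ ^ (1 / 2 : ℝ)) ^ 2 := by gcongr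
    _ = countTransfer L K Φ := sq_rpow_half _

/-- **THE COUNT SHADOW** (entrywise): `G(B,B') ≤ H(B,B')` — the block-coarse-grained one-body density
matrix is majorised, entry by entry, by the count-transfer affinity matrix of the count law
(`m_B² ≤ q_B` and Cauchy–Schwarz on each count fibre).  Off-diagonal long-range order at the block scale
FORCES count-transfer tolerance of `|Φ|²` at that scale. [folklore] -/
theorem blockCoherence_le_transferAffinity {L : ℝ} {K : ℕ} (hL : 0 < L) (hK : 0 < K)
    {Φ : Config (n + 1) → ℝ} (hΦm : Measurable Φ) (B B' : SubIdx K) :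
    blockCoherence L K Φ B B' ≤ transferAffinity L K Φ B B' :=
  shadow_core volume (measurable_countVec (L / (K : ℝ)) K) (measurable_blockAmp L K hΦm B)
    (measurable_blockAmp L K hΦm B') (blockAmp_sq_le_blockMass hL hK hΦm B)
    (blockAmp_sq_le_blockMass hL hK hΦm B')

/-- **The flat pairing is shadowed by the count transfer**: `∫ (∫ u_L Φ(·,Y) dx)² dY ≤ countTransfer L K Φ`
for every block number `K` (`∫ u_L Φ = Σ_B K^{-3/2} m_B`, expand the square, count shadow per pair and
fibre). [folklore] -/
theorem flatPairingSq_le_countTransfer {L : ℝ} {K : ℕ} (hL : 0 < L) (hK : 0 < K)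
    {Φ : Config (n + 1) → ℝ} (hΦm : Measurable Φ) :
    ∫⁻ Y : Config n, (∫⁻ x, ENNReal.ofReal (flatReal L x) * ENNReal.ofReal (Φ (Matrix.vecCons x Y))) ^ 2 ≤
      countTransfer L K Φ := by
  have hT := measurable_countVec (n := n) (L / (K : ℝ)) K
  have hmB : ∀ B : SubIdx K, Measurable fun Y => blockWeight K * blockAmp L K Φ B Y := fun B =>
    (measurable_blockAmp L K hΦm B).const_mul _
  simp_rw [lintegral_flat_slice hL hK hΦm]
  rw [lintegral_eq_tsum_fibre volume hT]
  unfold countTransfer fibreMass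
  refine ENNReal.tsum_le_tsum fun m => ?_
  set F : Set (Config n) := countVec (L / (K : ℝ)) K ⁻¹' {m} with hF
  have hmBB : ∀ B B' : SubIdx K, Measurable fun Y =>
      blockWeight K * blockAmp L K Φ B Y * (blockWeight K * blockAmp L K Φ B' Y) := fun B B' =>
    (hmB B).mul (hmB B')
  -- expand both squares as double sums
  simp_rw [sq, Finset.sum_mul_sum]
  rw [lintegral_finsetSum' _ fun B _ =>
    (Finset.measurable_sum _ fun B' _ => hmBB B B').aemeasurable]
  refine Finset.sum_le_sum fun B _ => ?_
  rw [lintegral_finsetSum' _ fun B' _ => (hmBB B B').aemeasurable]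
  refine Finset.sum_le_sum fun B' _ => ?_
  have hpt : ∀ Y, blockWeight K * blockAmp L K Φ B Y * (blockWeight K * blockAmp L K Φ B' Y) =
      blockWeight K * blockWeight K * (blockAmp L K Φ B Y * blockAmp L K Φ B' Y) := fun Y => by ring
  have hmAA : Measurable fun Y => blockAmp L K Φ B Y * blockAmp L K Φ B' Y :=
    (measurable_blockAmp L K hΦm B).mul (measurable_blockAmp L K hΦm B')
  simp_rw [hpt]
  rw [lintegral_const_mul _ hmAA]
  calc blockWeight K * blockWeight K * ∫⁻ Y in F, blockAmp L K Φ B Y * blockAmp L K Φ B' Y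
      ≤ blockWeight K * blockWeight K *
          ((∫⁻ Y in F, blockMass L K Φ B Y) ^ (1 / 2 : ℝ) *
            (∫⁻ Y in F, blockMass L K Φ B' Y) ^ (1 / 2 : ℝ)) := by
        gcongr
        exact setLIntegral_mul_le_of_sq_le volume F (measurable_blockAmp L K hΦm B)
          (measurable_blockAmp L K hΦm B') (blockAmp_sq_le_blockMass hL hK hΦm B)
          (blockAmp_sq_le_blockMass hL hK hΦm B')
    _ = blockWeight K * (∫⁻ Y in F, blockMass L K Φ B Y) ^ (1 / 2 : ℝ) *
          (blockWeight K * (∫⁻ Y in F, blockMass L K Φ B' Y) ^ (1 / 2 : ℝ)) := by ring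

/-- **COUNT RIGIDITY KILLS FLAT-MODE BEC, at every scale**: for a normalised `Φ ≥ 0` on `N = n + 1`
particles and EVERY block number `K`, `n(u_L) = ⟨u_L, γ_Φ u_L⟩ ≤ N · countTransfer L K Φ ≤ N · countAffinity L K Φ`.
Hence a condensate fraction `≥ c` in the flat mode forces count-transfer AND count-insertion affinity `≥ c`
of the count law of `|Φ|²` at all scales simultaneously: the count pieces below are NECESSARY. [folklore] -/
theorem occupation_flat_le_countTransfer {L : ℝ} {K : ℕ} (hL : 0 < L) (hK : 0 < K)
    {Φ : Config (n + 1) → ℝ} (hΦ0 : 0 ≤ Φ) (hΦm : Measurable Φ)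
    (hΦ1 : ∫⁻ Y : Config n, ∫⁻ x, ENNReal.ofReal (Φ (Matrix.vecCons x Y)) ^ 2 = 1) :
    occupation (n + 1) (fun x => ((flatReal L x : ℝ) : ℂ)) (fun X => (Φ X : ℂ)) ≤
      (n + 1 : ℝ≥0∞) * countTransfer L K Φ := by
  have hint := ae_integrable_mul_vecCons (flatReal_nonneg L) hΦ0 (measurable_flatReal L) hΦm
    (lintegral_flatReal_sq hL) hΦ1
  rw [occupation_ofReal_eq_ae (flatReal_nonneg L) hΦ0 hint]
  exact mul_le_mul' le_rfl (flatPairingSq_le_countTransfer hL hK hΦm)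

/-- The same in the insertion currency: `n(u_L) ≤ N · countAffinity L K Φ`. [folklore] -/
theorem occupation_flat_le_countAffinity {L : ℝ} {K : ℕ} (hL : 0 < L) (hK : 0 < K)
    {Φ : Config (n + 1) → ℝ} (hΦ0 : 0 ≤ Φ) (hΦm : Measurable Φ)
    (hΦ1 : ∫⁻ Y : Config n, ∫⁻ x, ENNReal.ofReal (Φ (Matrix.vecCons x Y)) ^ 2 = 1) :
    occupation (n + 1) (fun x => ((flatReal L x : ℝ) : ℂ)) (fun X => (Φ X : ℂ)) ≤
      (n + 1 : ℝ≥0∞) * countAffinity L K Φ :=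
  (occupation_flat_le_countTransfer hL hK hΦ0 hΦm hΦ1).trans
    (mul_le_mul' le_rfl (countTransfer_le_countAffinity hL hK hΦm))

/-- `(∫ u_L Φ(·,Y) dx)² ≤ P̂(Y)` pointwise (through the blocks: `∫ u_L Φ = Σ_B K^{-3/2} m_B`, Cauchy–Schwarz,
`m_B² ≤ q_B`, `Σ_B q_B ≤ P̂`). [folklore] -/
theorem flatPairing_sq_le_sliceSq {L : ℝ} {K : ℕ} (hL : 0 < L) (hK : 0 < K) {Φ : Config (n + 1) → ℝ}
    (hΦm : Measurable Φ) (Y : Config n) :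
    (∫⁻ x, ENNReal.ofReal (flatReal L x) * ENNReal.ofReal (Φ (Matrix.vecCons x Y))) ^ 2 ≤ sliceSq Φ Y := by
  have rpow_half_sq : ∀ m : ℝ≥0∞, (m ^ 2) ^ (1 / 2 : ℝ) = m := fun m => by
    rw [← ENNReal.rpow_two, ← ENNReal.rpow_mul]; norm_num
  have sq_rpow_half : ∀ m : ℝ≥0∞, (m ^ (1 / 2 : ℝ)) ^ 2 = m := fun m => by
    rw [← ENNReal.rpow_two, ← ENNReal.rpow_mul]; norm_num
  rw [lintegral_flat_slice hL hK hΦm]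
  calc (∑ B : SubIdx K, blockWeight K * blockAmp L K Φ B Y) ^ 2
      = (∑ B : SubIdx K, blockWeight K * (blockAmp L K Φ B Y ^ 2) ^ (1 / 2 : ℝ)) ^ 2 := by
        simp_rw [rpow_half_sq]
    _ ≤ ((∑ _B : SubIdx K, blockWeight K ^ 2) ^ (1 / 2 : ℝ) *
          (∑ B : SubIdx K, blockAmp L K Φ B Y ^ 2) ^ (1 / 2 : ℝ)) ^ 2 := by
        gcongr
        exact sum_mul_rpow_half_le _ _ _
    _ = ∑ B : SubIdx K, blockAmp L K Φ B Y ^ 2 := by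
        rw [sum_blockWeight_sq hK, ENNReal.one_rpow, one_mul, sq_rpow_half]
    _ ≤ ∑ B : SubIdx K, blockMass L K Φ B Y :=
        Finset.sum_le_sum fun B _ => blockAmp_sq_le_blockMass hL hK hΦm B Y
    _ ≤ sliceSq Φ Y := sum_blockMass_le_sliceSq hL hK hΦm Y

/-- **SUF is necessary as well**: `n(u_L) ≤ N · flatAffinity L Φ` for every normalised `Φ ≥ 0`; with gen 33's
`flatAffinity_le_labelAffinity` and `countAffinity_le_one`, a flat-mode fraction `≥ c₀` forces
`labelAffinity(K) ≥ c₀ ≥ c₀ · countAffinity(K)` at EVERY `K`: both count pieces below hold for any state with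
flat-mode BEC. [folklore] -/
theorem occupation_flat_le_flatAffinity {L : ℝ} (hL : 0 < L) {Φ : Config (n + 1) → ℝ} (hΦ0 : 0 ≤ Φ)
    (hΦm : Measurable Φ) (hΦ1 : ∫⁻ Y : Config n, ∫⁻ x, ENNReal.ofReal (Φ (Matrix.vecCons x Y)) ^ 2 = 1) :
    occupation (n + 1) (fun x => ((flatReal L x : ℝ) : ℂ)) (fun X => (Φ X : ℂ)) ≤
      (n + 1 : ℝ≥0∞) * flatAffinity L Φ := by
  have rpow_half_sq : ∀ m : ℝ≥0∞, (m ^ 2) ^ (1 / 2 : ℝ) = m := fun m => by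
    rw [← ENNReal.rpow_two, ← ENNReal.rpow_mul]; norm_num
  have hint := ae_integrable_mul_vecCons (flatReal_nonneg L) hΦ0 (measurable_flatReal L) hΦm
    (lintegral_flatReal_sq hL) hΦ1
  rw [occupation_ofReal_eq_ae (flatReal_nonneg L) hΦ0 hint]
  unfold flatAffinity
  refine mul_le_mul' le_rfl (lintegral_mono fun Y => ?_)
  rw [sq]
  refine mul_le_mul' le_rfl ?_
  calc ∫⁻ x, ENNReal.ofReal (flatReal L x) * ENNReal.ofReal (Φ (Matrix.vecCons x Y))
      = ((∫⁻ x, ENNReal.ofReal (flatReal L x) * ENNReal.ofReal (Φ (Matrix.vecCons x Y))) ^ 2) ^ (1 / 2 : ℝ) :=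
        (rpow_half_sq _).symm
    _ ≤ sliceSq Φ Y ^ (1 / 2 : ℝ) :=
        ENNReal.rpow_le_rpow (flatPairing_sq_le_sliceSq hL Nat.one_pos hΦm Y) (by norm_num)


end Summit.AtomisticToContinuum.BoseEinsteinCondensation.Theorems.BoxCountShadow
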